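import Literature.AnabelianGeometry.SemiGraphs.TemperedCompactInVerticialCpt
import HarnessLib

/-!
# [SemiAnbd] Thm 3.7 (iii) beyond finite `𝔾`: no compatible fixed branch-pair system of the TREES (the estrangement kill)

Mochizuki, *Semi-graphs of anabelioids*, Publ. RIMS **42** (2006), §3, Theorem 3.7 (iii), manuscript
pp. 40–41, proof p. 41 ("this implies [cf. Remark 2.2.1] that `H` is contained … for two distinct
branches `b`, `b'` abutting to `v` of edges `e`, `e'` … in the intersection of the images of `π̂₁(𝒢_e)`,
`π̂₁(𝒢_{e'})`, via `b`, `b'`. But since `𝒢` is assumed to be totally estranged, we thus conclude that `H` is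
trivial") [cite: MochizukiSemiAnbd2006, Thm 3.7(iii) p.41]; the author's *Comments* (2020), item (6)(b).

PROOF-ONLY (cell abc-iut, layer L3, GAP row G-t6g3-2 «Thm 3.7 (iii) / Cor 3.9 BEYOND FINITE 𝒢», sub-row
E2-bounded, kill step (iii) of L3-lead ruling α28 (1); seat abc-iut-w4-d080; no definition, no new named
fact).  abc-iut-w5-d160's `VerticialLevelData.hadj_of_bounded_dist` (`TemperedFixedGeodesicsBounded.lean`)
discharges the second clause `hadj` of the fixed-systems input (FIX∞) (bricks B1–B3:
`TemperedCompactInVerticialOfFixedSystems.lean`, `TemperedCompactInVerticialAtOfFixedSystems.lean`) for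
compatible `C`-fixed vertex systems at BOUNDED distance, modulo ONE tree-level binder `hnobp`: "`C ≠ 1`
fixes no compatible system `(w_i; β_i ≠ β'_i)` of a tree vertex with two distinct abutting branches above
any level".  This file DISCHARGES that binder from print's anabelioid input — the branch-level Remark
2.2.1 identification for compact subgroups, (I4′)_cpt (cell rulings ν2 / α12-1), which is FINITENESS-FREE
— and total estrangement (`Thm37Hypotheses.isTotallyEstranged`), by abc-iut-L3-t11 / abc-iut-w4-d064's
generic kill `noFixedBranchPairSystem_of_isTotallyEstranged_cpt` (stated over ARBITRARY level graphs):

* `VerticialLevelData.noFixedTreeBranchPairSystem_of_stabBranchPairCpt` — `hnobp` VERBATIM (d160's binder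
  shape, `∀ g ∈ C` form) from an (I4′)_cpt identification stated directly on the TREES `D.tree j` (the
  trees being level graphs like any other for the generic kill);
* `VerticialLevelData.noFixedTreeBranchPairSystem_of_stabBranchPairCpt_level` — `hnobp` from the USUAL
  (I4′)_cpt identification at level graphs `𝔾_j` under the trees (raw binders `level`, `quot` — equivariant
  IMMERSIONS `D.tree j ⟶ 𝔾_j` covering the transition maps —, `levelAct`, `levelTrans`; the field shapes
  of `FiniteLevelDataCpt` WITHOUT its finiteness instances, so that the producer of rung 1 for a countable
  `𝒢` — abc-iut-L3-t11's `stabBranchPairCpt'_ofTower'`, finiteness-free — feeds it): a compatible fixed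
  branch-pair system of the trees pushes down along the immersions to one of the levels
  (abc-iut-L3-t11's `SemiGraph.fixed_branchPair_map`), where the generic kill applies;
* `FiniteLevelDataCpt.noFixedTreeBranchPairSystem` — NON-VACUITY / consistency: for compact-form
  finite-level data (every FINITE `𝔾`, ASM-3) the binder `hnobp` HOLDS for every compact `C`.

With d160's file: `hadj` in the bounded case for a countable `𝒢` needs only (I4′)_cpt at the canonical
tower; the unbounded case is GAP G-t6g3-2b (SHAPES-Ggt6g32.md §(f)).  Nothing here asserts (FIX∞) for an
infinite `𝔾`; nothing bears on [IUTchIII] Cor. 3.12.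
-/

namespace Literature.AnabelianGeometry.SemiGraphs

namespace ProfiniteSemiGraph

open CategoryTheory Topology

universe v u

variable {𝒢 : ProfiniteSemiGraph.{u}} {c : TemperedPiChart 𝒢}

namespace VerticialLevelData

variable (D : VerticialLevelData.{v} 𝒢 c)

/-- **The estrangement kill at TREE level.**  If, for the subgroup `C` of `π₁^temp(𝒢)`, the branch-level
Remark 2.2.1 identification holds on the trees of the level data `D` — the elements of `C` stabilising a
compatible tree branch-pair system `(w_i; β_i ≠ β'_i)_{i ≥ j₀}` lie, after a homomorphism `ιQ` injective on
`C`, in two distinct branch-conjugates `ψ(xΠ_b x⁻¹) ∩ ψ(x'Π_{b'}x'⁻¹)` at a vertex `v` of `𝒢` — then, `𝒢`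
being totally estranged, `C ≠ 1` fixes NO such system: abc-iut-w5-d160's binder `hnobp`, verbatim.
(abc-iut-L3-t11 / abc-iut-w4-d064's `noFixedBranchPairSystem_of_isTotallyEstranged_cpt` with the trees as
levels.) [cite: MochizukiSemiAnbd2006, Thm 3.7(iii) p.41] -/
theorem noFixedTreeBranchPairSystem_of_stabBranchPairCpt (h𝒢 : 𝒢.Thm37Hypotheses) (C : Subgroup c.G)
    (stabC : ∀ (j₀ : D.J) (w : ∀ i : {i : D.J // j₀ ≤ i}, (D.tree i.1).Vertex)
      (β β' : ∀ i : {i : D.J // j₀ ≤ i}, (D.tree i.1).Branch),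
      (∀ i, β i ≠ β' i ∧ (D.tree i.1).abuts (β i) = some (w i) ∧ (D.tree i.1).abuts (β' i) = some (w i)) →
      (∀ ⦃i i' : {i : D.J // j₀ ≤ i}⦄ (h : i.1 ≤ i'.1), (D.trans h).vertexMap (w i') = w i ∧
        (D.trans h).branchMap (β i') = β i ∧ (D.trans h).branchMap (β' i') = β' i) →
      ∃ (Q : Type u) (_ : Group Q) (ιQ : c.G →* Q) (v : 𝒢.graph.Vertex) (b b' : 𝒢.graph.Branch)
        (hb : 𝒢.graph.abuts b = some v) (hb' : 𝒢.graph.abuts b' = some v) (ψ : 𝒢.Gv v →* Q) (x x' : 𝒢.Gv v),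
        Set.InjOn ιQ C ∧ Function.Injective ψ ∧ (b' ≠ b ∨ x⁻¹ * x' ∉ 𝒢.branchSubgroup b v hb) ∧
        ∀ g ∈ C, (∀ i, (D.act i.1 g).hom.vertexMap (w i) = w i ∧
          (D.act i.1 g).hom.branchMap (β i) = β i ∧ (D.act i.1 g).hom.branchMap (β' i) = β' i) →
          ιQ g ∈ ((𝒢.branchSubgroup b v hb).map (MulAut.conj x).toMonoidHom).map ψ ⊓
            ((𝒢.branchSubgroup b' v hb').map (MulAut.conj x').toMonoidHom).map ψ) :
    ∀ (j₀ : D.J) (w : ∀ i : {i : D.J // j₀ ≤ i}, (D.tree i.1).Vertex)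
      (β β' : ∀ i : {i : D.J // j₀ ≤ i}, (D.tree i.1).Branch),
      (∀ i, β i ≠ β' i ∧ (D.tree i.1).abuts (β i) = some (w i) ∧ (D.tree i.1).abuts (β' i) = some (w i)) →
      (∀ ⦃i i' : {i : D.J // j₀ ≤ i}⦄ (h : i.1 ≤ i'.1), (D.trans h).vertexMap (w i') = w i ∧
        (D.trans h).branchMap (β i') = β i ∧ (D.trans h).branchMap (β' i') = β' i) →
      (∀ (i : {i : D.J // j₀ ≤ i}), ∀ g ∈ C, (D.act i.1 g).hom.vertexMap (w i) = w i ∧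
        (D.act i.1 g).hom.branchMap (β i) = β i ∧ (D.act i.1 g).hom.branchMap (β' i) = β' i) → C = ⊥ :=
  fun j₀ w β β' hpair hcompat hfix =>
    noFixedBranchPairSystem_of_isTotallyEstranged_cpt h𝒢 c D.tree D.act D.trans C stabC j₀ w β β' hpair
      hcompat fun i γ => hfix i γ γ.2

/-- **The estrangement kill from the identification at LEVEL graphs under the trees.**  Let level graphs
`𝔾_j` (`level`, NOT assumed finite) lie under the trees of `D` through equivariant IMMERSIONS
`quot j : D.tree j ⟶ 𝔾_j` (the universal graph-coverings `𝒢_{∞,j} → 𝔾_j`) covering the transition maps, and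
let the branch-level Remark 2.2.1 identification (I4′)_cpt hold for `C` at these levels (the field shape of
`FiniteLevelDataCpt.stabBranchPairCpt'` at `C`, without its finiteness instances).  Then, `𝒢` being totally
estranged, `C ≠ 1` fixes no compatible branch-pair system of the TREES (abc-iut-w5-d160's binder `hnobp`):
such a system maps along the immersions (abc-iut-L3-t11's `SemiGraph.fixed_branchPair_map`: distinct
branches at a vertex stay distinct) to a compatible `C`-fixed branch-pair system of the levels, killed by
`noFixedBranchPairSystem_of_isTotallyEstranged_cpt`. [cite: MochizukiSemiAnbd2006, Thm 3.7(iii) p.41] -/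
theorem noFixedTreeBranchPairSystem_of_stabBranchPairCpt_level (h𝒢 : 𝒢.Thm37Hypotheses)
    (C : Subgroup c.G) (level : D.J → SemiGraph.{u}) (quot : ∀ j, D.tree j ⟶ level j)
    (quot_isImmersion : ∀ j, SemiGraph.IsImmersion (quot j)) (levelAct : ∀ j, c.G →* Aut (level j))
    (act_quot : ∀ (j : D.J) (g : c.G), (D.act j g).hom ≫ quot j = quot j ≫ (levelAct j g).hom)
    (levelTrans : ∀ ⦃i j : D.J⦄, i ≤ j → (level j ⟶ level i))
    (trans_quot : ∀ ⦃i j : D.J⦄ (h : i ≤ j), D.trans h ≫ quot i = quot j ≫ levelTrans h)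
    (stabC : ∀ (j₀ : D.J) (w : ∀ i : {i : D.J // j₀ ≤ i}, (level i.1).Vertex)
      (β β' : ∀ i : {i : D.J // j₀ ≤ i}, (level i.1).Branch),
      (∀ i, β i ≠ β' i ∧ (level i.1).abuts (β i) = some (w i) ∧ (level i.1).abuts (β' i) = some (w i)) →
      (∀ ⦃i i' : {i : D.J // j₀ ≤ i}⦄ (h : i.1 ≤ i'.1), (levelTrans h).vertexMap (w i') = w i ∧
        (levelTrans h).branchMap (β i') = β i ∧ (levelTrans h).branchMap (β' i') = β' i) →
      ∃ (Q : Type u) (_ : Group Q) (ιQ : c.G →* Q) (v : 𝒢.graph.Vertex) (b b' : 𝒢.graph.Branch)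
        (hb : 𝒢.graph.abuts b = some v) (hb' : 𝒢.graph.abuts b' = some v) (ψ : 𝒢.Gv v →* Q) (x x' : 𝒢.Gv v),
        Set.InjOn ιQ C ∧ Function.Injective ψ ∧ (b' ≠ b ∨ x⁻¹ * x' ∉ 𝒢.branchSubgroup b v hb) ∧
        ∀ g ∈ C, (∀ i, (levelAct i.1 g).hom.vertexMap (w i) = w i ∧
          (levelAct i.1 g).hom.branchMap (β i) = β i ∧ (levelAct i.1 g).hom.branchMap (β' i) = β' i) →
          ιQ g ∈ ((𝒢.branchSubgroup b v hb).map (MulAut.conj x).toMonoidHom).map ψ ⊓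
            ((𝒢.branchSubgroup b' v hb').map (MulAut.conj x').toMonoidHom).map ψ) :
    ∀ (j₀ : D.J) (w : ∀ i : {i : D.J // j₀ ≤ i}, (D.tree i.1).Vertex)
      (β β' : ∀ i : {i : D.J // j₀ ≤ i}, (D.tree i.1).Branch),
      (∀ i, β i ≠ β' i ∧ (D.tree i.1).abuts (β i) = some (w i) ∧ (D.tree i.1).abuts (β' i) = some (w i)) →
      (∀ ⦃i i' : {i : D.J // j₀ ≤ i}⦄ (h : i.1 ≤ i'.1), (D.trans h).vertexMap (w i') = w i ∧
        (D.trans h).branchMap (β i') = β i ∧ (D.trans h).branchMap (β' i') = β' i) →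
      (∀ (i : {i : D.J // j₀ ≤ i}), ∀ g ∈ C, (D.act i.1 g).hom.vertexMap (w i) = w i ∧
        (D.act i.1 g).hom.branchMap (β i) = β i ∧ (D.act i.1 g).hom.branchMap (β' i) = β' i) → C = ⊥ := by
  intro j₀ w β β' hpair hcompat hfix
  -- push the tree system down along the immersions `quot`
  have key : ∀ i : {i : D.J // j₀ ≤ i},
      (quot i.1).branchMap (β i) ≠ (quot i.1).branchMap (β' i) ∧
      (level i.1).abuts ((quot i.1).branchMap (β i)) = some ((quot i.1).vertexMap (w i)) ∧
      (level i.1).abuts ((quot i.1).branchMap (β' i)) = some ((quot i.1).vertexMap (w i)) ∧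
      ∀ γ : C, (((levelAct i.1).comp C.subtype) γ).hom.vertexMap ((quot i.1).vertexMap (w i)) =
          (quot i.1).vertexMap (w i) ∧
        (((levelAct i.1).comp C.subtype) γ).hom.branchMap ((quot i.1).branchMap (β i)) =
          (quot i.1).branchMap (β i) ∧
        (((levelAct i.1).comp C.subtype) γ).hom.branchMap ((quot i.1).branchMap (β' i)) =
          (quot i.1).branchMap (β' i) :=
    fun i => SemiGraph.fixed_branchPair_map ((D.act i.1).comp C.subtype) ((levelAct i.1).comp C.subtype)
      (quot i.1) (quot_isImmersion i.1) (fun γ => act_quot i.1 γ) (hpair i).1 (hpair i).2.1 (hpair i).2.2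
      (fun γ => hfix i γ γ.2)
  refine noFixedBranchPairSystem_of_isTotallyEstranged_cpt h𝒢 c level levelAct levelTrans C stabC j₀
    (fun i => (quot i.1).vertexMap (w i)) (fun i => (quot i.1).branchMap (β i))
    (fun i => (quot i.1).branchMap (β' i)) (fun i => ⟨(key i).1, (key i).2.1, (key i).2.2.1⟩)
    (fun i i' h => ?_) (fun i γ => (key i).2.2.2 γ)
  -- compatibility downstairs, through the squares `trans ≫ quot = quot ≫ levelTrans`
  obtain ⟨hw, hβ, hβ'⟩ := hcompat h
  have sqV := congrArg (fun ψ : D.tree i'.1 ⟶ level i.1 => ψ.vertexMap (w i')) (trans_quot h)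
  have sqB := congrArg (fun ψ : D.tree i'.1 ⟶ level i.1 => ψ.branchMap (β i')) (trans_quot h)
  have sqB' := congrArg (fun ψ : D.tree i'.1 ⟶ level i.1 => ψ.branchMap (β' i')) (trans_quot h)
  simp only [SemiGraph.comp_vertexMap, SemiGraph.comp_branchMap, Function.comp_apply, hw, hβ, hβ']
    at sqV sqB sqB'
  exact ⟨sqV.symm, sqB.symm, sqB'.symm⟩

end VerticialLevelData

namespace FiniteLevelDataCpt

/-- **Non-vacuity / consistency at finite `𝔾`**: for compact-form finite-level data of a chart (ASM-3 at
every FINITE `𝔾`) and every COMPACT `C`, abc-iut-w5-d160's binder `hnobp` on the trees HOLDS — the field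
(I4′)_cpt at `C` and total estrangement, pushed up from the finite levels
(`VerticialLevelData.noFixedTreeBranchPairSystem_of_stabBranchPairCpt_level`).
[cite: MochizukiSemiAnbd2006, Thm 3.7(iii) p.41] -/
theorem noFixedTreeBranchPairSystem (D : FiniteLevelDataCpt.{v} 𝒢 c) (h𝒢 : 𝒢.Thm37Hypotheses)
    (C : Subgroup c.G) (hC : IsCompact (C : Set c.G)) :
    ∀ (j₀ : D.J) (w : ∀ i : {i : D.J // j₀ ≤ i}, (D.tree i.1).Vertex)
      (β β' : ∀ i : {i : D.J // j₀ ≤ i}, (D.tree i.1).Branch),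
      (∀ i, β i ≠ β' i ∧ (D.tree i.1).abuts (β i) = some (w i) ∧ (D.tree i.1).abuts (β' i) = some (w i)) →
      (∀ ⦃i i' : {i : D.J // j₀ ≤ i}⦄ (h : i.1 ≤ i'.1), (D.trans h).vertexMap (w i') = w i ∧
        (D.trans h).branchMap (β i') = β i ∧ (D.trans h).branchMap (β' i') = β' i) →
      (∀ (i : {i : D.J // j₀ ≤ i}), ∀ g ∈ C, (D.act i.1 g).hom.vertexMap (w i) = w i ∧
        (D.act i.1 g).hom.branchMap (β i) = β i ∧ (D.act i.1 g).hom.branchMap (β' i) = β' i) → C = ⊥ :=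
  D.toVerticialLevelData.noFixedTreeBranchPairSystem_of_stabBranchPairCpt_level h𝒢 C D.level D.quot
    D.quot_isImmersion D.levelAct D.act_quot D.levelTrans D.trans_quot (D.stabBranchPairCpt' C hC)

end FiniteLevelDataCpt

end ProfiniteSemiGraph

end Literature.AnabelianGeometry.SemiGraphs
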